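import Mathlib
import HarnessLib
import HarnessLib.Audit
import Summits.RiemannHypothesis.Statement
import Summits.RiemannHypothesis.RiemannHypothesis.Theorems.Splittings.ScrewLatticeThinWall
import Summits.RiemannHypothesis.RiemannHypothesis.Theorems.Splittings.ScrewLatticePringsheim
import HarnessLib.Audit.Status.Attr

/-!
Route: ScrewFabry

DORMANT since 2026-09-02T00:24:35Z (reconciler: no traction for 5 d (last activity statement-attached at 2026-08-27T23:21:19Z); parked, not closed — `ledger route dormant route-RiemannHypothesis-ScrewFabry --off` to reactivate) — unstaffed, not closed; items shared with open routes are served there. `ledger route dormant <id> --off` reactivates.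

# Route ScrewFabry — X-16 FABRY EXCHANGE — Ψ-negativity of windowed density Δ/2 on the lattice
against a wall-free sector of half-angle πΔ; RH ⟺ SectorExchange(1) ∧ TW(1), via Fabry–Pólya sign
changes

D-0145 LINE of seat rh-idea-1 (technique: splitting / criterion search; bears_on LADDER-RH rung S-P
«search for NEW splits (screw §19 ff.)»,
column SCREW §19–20). It suffices to show X = X-16: FabryBridge ∧ SectorExchange ∧ FabryFact ∧
ThinWallOne ⟹ RH, where the PROVABLE
content is the RH-free crux `FabryBridge`: for every step h > 0 and every rate Δ ≥ 0, if the
NEGATIVE samples of Ψ = zetaScrew on hℕ have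
windowed density at most Δ/2 (∀ r ∈ (0,1) ∀ ε ∃ T ∀ t ≥ T: #{m ∈ (t,(1+r)t] : Ψ(mh) < 0} ≤ (Δ/2 +
ε)·r·t — NO size constraint on the negative
values) and the closed wall closure(aliasedPoleSet h) misses the SECTOR {‖z‖ < 1, |arg z| ≤ πΔ},
then CEIL(h) = LatticeCeiling h. Mechanism:
sign changes of a real sequence are at most twice its negative places per window, so the sign-change
set of (Ψ(kh))_k has Pólya maximum
density ≤ Δ; the FABRY–PÓLYA theorem (a real power series whose sign changes have maximum density ≤
Δ has a singular point on the arc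
|arg z| ≤ πΔ of its circle of convergence; carried as the named Literature fact `FabryFact`, stated
in Pringsheim form) applied to the lattice
generating function Σ Ψ(kh) z^k — whose Borel continuation B_h is analytic on ball 0 1 ∖
closure(wall), hence on the whole sector — forces
the radius of convergence up to 1, i.e. |Ψ(kh)| ≤ K_ε e^{ε k}. The EXCHANGE conjunct
`SectorExchange` (∃ Δ ≥ 0: negativity density ≤ Δ/2 at
step 1 ∧ sector-free wall at step 1; RH-implied with Δ = 0, Sketch5 `sectorExchange_of_rh`) and
`ThinWallOne` = TW(1) (RH-implied,
`thinWall_of_rh`) complete the split RH ⟺ SectorExchange(1) ∧ TW(1) through the landed row X-10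
`rh_of_latticeCeiling_of_thinWall`. At Δ = 0
the row reads RH ⟺ NEGDENS₀(1) ∧ RayFree(1) ∧ TW(1): X-15's sub-exponential FLOOR is replaced by
«negative samples have windowed density 0»,
a pure SIGN-PATTERN statistic. Nothing here bears on the truth of RH.
Lean: `Summit.RiemannHypothesis.RiemannHypothesis.Theses.ScrewFabry.FabryBridge →
Summit.RiemannHypothesis.RiemannHypothesis.Theses.ScrewFabry.SectorExchange →
Summit.RiemannHypothesis.RiemannHypothesis.Theses.ScrewFabry.FabryFact →
Summit.RiemannHypothesis.RiemannHypothesis.Theses.ScrewFabry.ThinWallOne → Summit.RiemannHypothesis`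

## Assembly
Pure logic over the landed row X-10, kernel-checked in the seat folder (Sketch5.lean
`assembly_holds`, 3 lines, rc 0): take Δ from
SectorExchange; FabryBridge (fed FabryFact) at h = 1 gives LatticeCeiling 1;
`rh_of_latticeCeiling_of_thinWall one_pos` with TW(1) gives RH.
The deciding theorem is `closes (h₁ : FabryBridge) (h₂ : SectorExchange) (h₃ : FabryFact) (h₄ :
ThinWallOne) (hA : Assembly) := hA h₃ h₁ h₂ h₄`;
the Assembly item is PROVABLE NOW (proof text attached as evidence at birth).

Rationale: WHY THIS LINE. Mechanism: every Ψ-side hypothesis on the screw desk measures the SIZE of Ψ's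
negative part (positivity LP, floors SEF / X-1…X-8‴, the X-15
floor) or the two-sided size (CEIL, X-9…X-13); none measures HOW OFTEN Ψ is negative. The
Fabry–Pólya sign-change theorem (Fabry 1898,
Pólya 1929 maximum density; complete proof in Bieberbach, Analytische Fortsetzung 1955; modern
statement Eremenko arXiv:0709.2360 Thm A
[corpus:paper:arxiv-0709.2360 p2]) converts exactly that frequency into an ANGULAR constraint on the
singularities: sign-change density Δ
buys a singular point within angle πΔ of the positive ray. On Suzuki's lattice generating function
the singularities are the folded far zeros
e^{∓(ρ−1/2)h}, whose argument is ∓γh mod 2π — so the theorem prices the residue classes of off-line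
ordinates γ mod 2π/h against the
density of negative samples: an EXCHANGE RATE (πΔ of wall-free arc per Δ/2 of negativity density)
that no listed route states. It is the
lattice transplant of the Pólya–Kaczorowski sign-change theory of ψ(x) − x (continuum: few sign
changes of a Mellin numerator force a real
singularity, whence ≥ (γ₁/π) log T sign changes; Kaczorowski, Acta Arith. 45 (1985)
[graph:doi:10.4064/aa-45-1-65-74]; the attained-Θ
localisation is Montgomery–Vaughan Thm 15.8
[corpus:book:montgomery2007-multiplicative-number-theory-i-classical-theory p361]), exactly as
X-15 transplanted Landau's one-signedness lemma; X-15 is this line's Δ = 0, no-sign-change corner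
(its kernel
`ScrewLatticePringsheim.latticeCeiling_of_floor_of_rayFree`, landed tonight, is the BC5 rung).
Imported from complex analysis: Fabry–Pólya
(as a named fact); from the tree: `hasSum_latticeGF`, `latticeGF_eq_borel`,
`ScrewBorel.differentiableOn_borel`, row X-10.

RANKED CRUXES. #2 FabryBridge (crux) — RH-free theorem about ζ given the named fact (the provable
content). FabryFact → for every h > 0 and Δ ≥ 0: if #{m ∈ (t,(1+r)t] : Ψ(mh) < 0} ≤ (Δ/2 + ε) r t
for all r ∈ (0,1), ε > 0 and t ≥ T(r,ε), and no z with ‖z‖ < 1, |arg z| ≤ πΔ lies in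
closure(aliasedPoleSet h), then LatticeCeiling h. [deps: FabryFact] [difficulty: M] (why it might
fail: Given the fact only Lean cost: the window combinatorics «sign-change places ≤ 2·negative
places + 1», and the HasSum / sector-analyticity bookkeeping already done for X-15 in
ScrewLatticePringsheim (#470). Risk sits in FabryFact's transcription, not here.) [arXiv:0709.2360,
Suzuki2023, corpus:book:montgomery2007-multiplicative-number-theory-i-classical-theory p361]
#3 SectorExchange (crux) — The exchange conjunct at step 1 (RH-implied, the searchable object;
weakest member of the Δ-family): there is a rate Δ ≥ 0 such that (Ψ-side) the negative samples Ψ(m),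
m ∈ ℕ, have windowed density ≤ Δ/2, AND (zero-side) the closed wall closure(aliasedPoleSet 1)
contains no z with ‖z‖ < 1 and |arg z| ≤ πΔ — in zero language: no off-line zero has −γ mod 2π in
[−πΔ, πΔ] with its folded point inside 𝔻, and no sequence of off-line zeros has γ_j mod 2π → [−πΔ,
πΔ] with deviations converging in (0,1/2]. Under RH it holds with Δ = 0 (Sketch5
`sectorExchange_of_rh`). [difficulty: open-problem] (why it might fail: False iff ¬RH and for EVERY
Δ either Ψ(m) < 0 on a set of windowed density > Δ/2 or folded off-line zeros reach the sector |arg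
z| ≤ πΔ (γ mod 2π near 0); nothing is known at step 1 — under ¬RH Landau gives Ψ < 0 infinitely
often, not with positive density.) [Suzuki2023, arXiv:0709.2360, doi:10.4064/aa-45-1-65-74]
#9 FabryFact (support) — NAMED LITERATURE FACT (RH-free, proved in print; to be typed as a
Literature `def … : Prop` with cite tags — Fabry 1898, Pólya 1929 (maximum density), Bieberbach 1955
(complete proof), Eremenko arXiv:0709.2360 Thm A), in Pringsheim form: for a real sequence a, a
function F, b > 0 and Δ ≥ 0 — if the sign-change places of a (Fabry's sense: a k · a m < 0 for the
previous non-zero index k) number at most (Δ + ε)·r·t in every window (t,(1+r)t] for t large (this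
gives Pólya maximum density ≤ Δ), F is analytic at every z with ‖z‖ < b and |arg z| ≤ πΔ, and Σ a_n
z^n = F(z) near 0 — then Σ a_n t^n converges for every t ∈ [0, b). Δ = 0 without sign changes is
Vivanti–Pringsheim (`Literature.Analysis.Complex.summable_mul_pow_of_nonneg_of_analyticAt`).
[difficulty: L] [arXiv:0709.2360, Titchmarsh1939, Remmert1991]
#9 ThinWallOne (support) — TW(1): the closed wall has zero length in 𝔻 (row X-10's hypothesis;
RH-implied, `thinWall_of_rh`). [difficulty: open-problem] [Suzuki2023,
corpus:book:ross2002-generalized-analytic-continuation p33]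

TWO-LAYER PLAN. FabryBridge ⇐ (F1) window combinatorics: sign-change places ≤ 2·negative places + 1
per window, so negativity density ≤ Δ/2 + ε gives
sign-change density ≤ Δ + 3ε (finite, S⁺) → (F2) the fact applied with a = Ψ(·h), F = B_h, b = 1
(germ `hasSum_latticeGF` +
`latticeGF_eq_borel` on ‖z‖ < e^{−h/2}; analyticity on the sector from
`ScrewBorel.differentiableOn_borel` since the sector misses the
closed wall) ⟹ Σ Ψ(kh) t^k summable for all t ∈ [0,1) (M, hardest) → (F3) bounded terms at t =
e^{−ε} ⟹ LatticeCeiling h (S). Skeleton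
with the three stubs and the proved composition `FabryBridge_of` in the seat folder
(bc/Fabry_birth_pre.lean, rc 0, sorries = 3 = stubs).

KILL CRITERIA. A refutation of FabryFact AS TYPED (a mis-transcription of Fabry's hypothesis or
conclusion) breaks the route `refuted-misstated` and is
repaired by re-typing the fact from Eremenko Thm A (the mathematics is a theorem since 1898/1929). A
refutation of FabryBridge given the
fact would expose an error in the germ/sector bookkeeping shared with X-15. A cheap proof of
SectorExchange(1) ⟹ RH inside kernel methods
would make the row a costume (not expected: the blind models B14/B16/B16′ satisfy CEIL, hence every
Ψ-side clause, and their walls are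
circles through the sector). Critic grade «variant of X-15» with a STRIKE retires the line to a
remark under X-15.

NOT DECOMPOSED YET. (F1)–(F3) are layer-2 children for the prover. The continuum dictionary
(Pólya–Kaczorowski: V(T) ≥ (γ*/π) log T sign changes of ψ − x
when the singularity nearest the real axis on the critical abscissa has ordinate γ*) is a remark
motivating the exchange rate, not an item.
The fixed-Δ members of the family (Δ = 0: NEGDENS₀ ∧ RayFree; Δ → 1: half-density negativity ∧
almost no off-line ordinate class) are not
filed separately; the route states the weakest (existential) member.

CHEAPEST FALSIFIER. (i) Costume/tautology: `#h21_crux_probe … summit := Summit.RiemannHypothesis` on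
FabryBridge / SectorExchange / FabryFact / ThinWallOne /
Assembly — 5/5 CLEAN before filing (bc/probe5.out; FabryFact re-run with 90 s batteries CLEAN;
Assembly informational only); BC2 `C → RH`
probes fail 4/4 (bc/probe5_bc2.lean); converses RH → SectorExchange / ThinWallOne close
(consequences of RH used toward RH — fine).
(ii) Transcription of the fact vs Eremenko Thm A p.2: the windowed bound for every r ∈ (0,1) gives
Pólya maximum density ≤ Δ; β_k = 0
(real coefficients); the arc I_Δ at radius R < b lies in the sector where F is analytic and
continues the series along radii, contradicting
«a singular point on I_Δ»; Δ ≥ 1 is trivially consistent — checked by hand. (iii) Instrument row: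
any negative sample Ψ(m) < 0 is already
¬RH (Suzuki Thm 1.7), so the Ψ-side clause is unfalsifiable by finite data exactly like LP; the
zero-side clause is refuted only by an
off-line zero whose ordinate class γ mod 2π enters [−πΔ, πΔ].

NUMBERS. Aliased poles satisfy e^{−h/2} ≤ ‖p‖ ≤ e^{h/2}, so 0 is never a wall point and the germ
lives on ‖z‖ < e^{−h/2}; the factor 2 between
negative places and sign changes is sharp (pattern + − + − …). No hand-picked thresholds (checklist
4c(iv)): Δ is existential in the
conjunct and universal in the bridge; all densities carry ∀ ε.

DEFINITION REQUESTS. FabryFact should eventually live in `Literature/Analysis/Complex/` as a cited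
named fact (def, no proof required by the model); filed here
as a route support item so that `closes` is certified today. No new notion otherwise (`Set.ncard`,
`Complex.arg`, tree decls).

Novelty: Searches (2026-08-27): lit search "sign changes coefficients singular point arc Polya" (corpus 1
doc: [corpus:paper:arxiv-0709.2360 p2] Eremenko, Densities in Fabry's theorem — Thm A = Fabry's
theorem with Pólya maximum density, Pringsheim as the special case, history); lit search --hybrid
"sign changes remainder term prime number theorem Polya Kaczorowski Landau theorem generalization"
(8 docs: [corpus:book:montgomery2007-multiplicative-number-theory-i-classical-theory p361] Thm 15.8
attained-Θ sign-change localisation = the FLOOR family's dominant-term mechanism; Ivić 1985 p377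
Pintz on sign changes of M(x)); crossref [graph:doi:10.4064/aa-45-1-65-74] Kaczorowski 1985 «On
sign-changes in the remainder-term of the prime-number formula II» (continuum theory); lit galaxy
search "Vorzeichenwechsel|sign changes in the remainder|Fabry" --star all (noise only), --star
panama --title-contains "complex analysis" "Fabry" → [galaxy:panama:231387068104787 @174080] Simon,
Basic Complex Analysis (Fabry GAP theorem only, not the sign-change form); rg
'sign.chang|Fabry|Vorzeichen' over lean/Literature/Analysis/Complex (Jensen-programme sign-change
lemmas only; no Fabry); desk census KEYS-RH-LINES-D0145 / rh-split HANDOFF §17–§21 (no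
density-of-negativity conjunct, no angular exchange).
Nearest prior art found: X-15 `route-RiemannHypothesis-ScrewPringsheim` (this seat, tonight: floor +
ray-free ⟹ CEIL via Pringsheim = the Δ = 0, no-sign-change corner); Pólya–Kaczorowski continuum
sign-chang  [refs: 10.4064/aa-45-1-65-74, 0709.2360, paper:arxiv-0709.2360, book:montgomery2007-multiplicative-number-theory-i-classical-theory, doi:10.4064/aa-45-1-65-74]

Barriers (technique_class: splitting, criterion-search, borel-continuation): - technique_class: splitting, criterion-search, borel-continuation
- Literature.Barriers.RiemannHypothesis.DavenportHeilbronn: outside — no zero-free region or Euler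
product is used; the bridge runs through ζ's explicit-formula dictionary (`latticeGF_eq_borel`,
Suzuki2023); a Davenport–Heilbronn function has negative Ψ-samples of positive density to start
with, so the row does not pretend to see RH-failure for Euler-product-free functions.
- Literature.Barriers.RiemannHypothesis.BrouckeDebruyneRevesz2023_thm13: outside (Beurling
counterexamples) — no Beurling-prime input; the bridge is a statement about one fixed ℓ¹ Borel
family and a real power series.
- Literature.Barriers.RiemannHypothesis.ExceptionalZero: outside — no Dirichlet character, no
zero-free region, no class-number bound; «Pólya» here is the 1929 maximum-density theorem on power
series, not Pólya–Vinogradov.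
- Literature.Barriers.RiemannHypothesis.BohrDenseValues: outside — no value distribution; the
invisibility results that DO bear on this class are the tree blind models B14/B16/B16′
(`ScrewLatticeWolffModel.exists_blind_model`, `exists_blind_model_discrete`), honoured: their F is
holomorphic on 𝔻, so they satisfy every Ψ-side clause incl. negativity density 0, and their
one-circle walls CROSS every sector — the zero-side clause is exactly what excludes them; the bridge
claims nothing about blind configurations (it produces CEIL, which they have).
- Negatives index: none of stmt-RiemannHypothesis-15969/15970/1

History (route lifecycle, newest last):
- 2026-09-02T00:24:35Z · DORMANT — reconciler: no traction for 5 d (last activity statement-attached at 2026-08-27T23:21:19Z); parked, not closed — `ledger route dormant route-RiemannHypothesis-S (operator:999:2416144)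

sub-problem: RiemannHypothesis · status: dormant · opened planner-rh-idea-1-g0-0 2026-08-27T22:10:21Z · rev 0 · ledger route-RiemannHypothesis-ScrewFabry
GENERATED by the gate from the ledger (D-0016/17). Provers cite these decls: `theorem foo : Summit.RiemannHypothesis.RiemannHypothesis.Theses.ScrewFabry.<Decl> := …` in Summits/RiemannHypothesis/RiemannHypothesis/Theorems/<Name>.lean.
-/

namespace Summit.RiemannHypothesis.RiemannHypothesis.Theses.ScrewFabry

open scoped BigOperators Topology Manifold Classical MeasureTheory ProbabilityTheory Matrix InnerProductSpace ComplexConjugate ContinuousMap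
open Filter Set Function TopologicalSpace MeasureTheory

attribute [summit_statement] _root_.Summit.RiemannHypothesis

open Summit

/-- item stmt-RiemannHypothesis-23057 · crux · rank 3 · open · by planner
why it might fail: False iff ¬RH and for EVERY Δ either Ψ(m) < 0 on a set of windowed density > Δ/2 or folded off-line zeros reach the sector |arg z| ≤ πΔ (γ mod 2π near 0); nothing is known at step 1 — under ¬RH Landau gives Ψ < 0 infinitely often, not with positive density.
sources: Suzuki2023, arXiv:0709.2360, doi:10.4064/aa-45-1-65-74
[crux] The exchange conjunct at step 1 (RH-implied, the searchable object; weakest member of the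
Δ-family): there is a rate Δ ≥ 0 such that (Ψ-side) the negative samples Ψ(m), m ∈ ℕ, have windowed
density ≤ Δ/2, AND (zero-side) the closed wall closure(aliasedPoleSet 1) contains no z with ‖z‖ < 1
and |arg z| ≤ πΔ — in zero language: no off-line zero has −γ mod 2π in [−πΔ, πΔ] with its folded
point inside 𝔻, and no sequence of off-line zeros has γ_j mod 2π → [−πΔ, πΔ] with deviations
converging in (0,1/2]. Under RH it holds with Δ = 0 (Sketch5 `sectorExchange_of_rh`). [difficulty:
open-problem] -/
@[route_item "route-RiemannHypothesis-ScrewFabry", crux]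
def SectorExchange : Prop :=
  ∃ Δ : ℝ, 0 ≤ Δ ∧ (∀ r : ℝ, 0 < r → r < 1 → ∀ ε : ℝ, 0 < ε → ∃ T : ℝ, ∀ t : ℝ, T ≤ t → (Set.ncard {m : ℕ | t < m ∧ (m : ℝ) ≤ (1 + r) * t ∧ Literature.NumberTheory.LFunctions.zetaScrew (m * (1 : ℝ)) < 0} : ℝ) ≤ (Δ / 2 + ε) * (r * t)) ∧ (∀ z : ℂ, ‖z‖ < 1 → |Complex.arg z| ≤ Real.pi * Δ → z ∉ closure (Theorems.Splittings.ScrewLatticeContinuation.aliasedPoleSet 1))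

/-- item stmt-RiemannHypothesis-23058 · support · rank 9 · open · by planner
sources: arXiv:0709.2360, Titchmarsh1939, Remmert1991
[support] NAMED LITERATURE FACT (RH-free, proved in print; to be typed as a Literature `def … :
Prop` with cite tags — Fabry 1898, Pólya 1929 (maximum density), Bieberbach 1955 (complete proof),
Eremenko arXiv:0709.2360 Thm A), in Pringsheim form: for a real sequence a, a function F, b > 0 and
Δ ≥ 0 — if the sign-change places of a (Fabry's sense: a k · a m < 0 for the previous non-zero index
k) number at most (Δ + ε)·r·t in every window (t,(1+r)t] for t large (this gives Pólya maximum
density ≤ Δ), F is analytic at every z with ‖z‖ < b and |arg z| ≤ πΔ, and Σ a_n z^n = F(z) near 0 —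
then Σ a_n t^n converges for every t ∈ [0, b). Δ = 0 without sign changes is Vivanti–Pringsheim
(`Literature.Analysis.Complex.summable_mul_pow_of_nonneg_of_analyticAt`). [difficulty: L] -/
@[route_item "route-RiemannHypothesis-ScrewFabry", crux (experiment := "instrument: ass EMPTY under STANDARD v2 · (V′) ≤ 8 default NO · Bui–Hall sentence · W13 probe only on the human's word · XL formal-infrastructure K1s d…") (source := "director HOURLY-RH l.1295, 2026-09-01")]
def FabryFact : Prop :=
  ∀ (a : ℕ → ℝ) (F : ℂ → ℂ) (b Δ : ℝ), 0 < b → 0 ≤ Δ → (∀ r : ℝ, 0 < r → r < 1 → ∀ ε : ℝ, 0 < ε → ∃ T : ℝ, ∀ t : ℝ, T ≤ t → (Set.ncard {m : ℕ | t < m ∧ (m : ℝ) ≤ (1 + r) * t ∧ ∃ k : ℕ, k < m ∧ a k * a m < 0 ∧ ∀ j : ℕ, k < j → j < m → a j = 0} : ℝ) ≤ (Δ + ε) * (r * t)) → (∀ z : ℂ, ‖z‖ < b → |Complex.arg z| ≤ Real.pi * Δ → AnalyticAt ℂ F z) → (∃ ε : ℝ, 0 < ε ∧ ∀ z : ℂ,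 ‖z‖ < ε → HasSum (fun n ↦ (a n : ℂ) * z ^ n) (F z)) → ∀ t : ℝ, 0 ≤ t → t < b → Summable (fun n ↦ a n * t ^ n)

/-- item stmt-RiemannHypothesis-23056 · crux · rank 2 · closed · proved by Summit.RiemannHypothesis.RiemannHypothesis.Theorems.ScrewFabry.fabryBridge_proof (prover) · by planner
why it might fail: Given the fact only Lean cost: the window combinatorics «sign-change places ≤ 2·negative places + 1», and the HasSum / sector-analyticity bookkeeping already done for X-15 in ScrewLatticePringsheim (#470). Risk sits in FabryFact's transcription, not here.
sources: arXiv:0709.2360, Suzuki2023, corpus:book:montgomery2007-multiplicative-number-theory-i-classical-theory p361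
[crux] RH-free theorem about ζ given the named fact (the provable content). FabryFact → for every h
> 0 and Δ ≥ 0: if #{m ∈ (t,(1+r)t] : Ψ(mh) < 0} ≤ (Δ/2 + ε) r t for all r ∈ (0,1), ε > 0 and t ≥
T(r,ε), and no z with ‖z‖ < 1, |arg z| ≤ πΔ lies in closure(aliasedPoleSet h), then LatticeCeiling
h. [deps: FabryFact] [difficulty: M] -/
@[route_item "route-RiemannHypothesis-ScrewFabry", crux]
def FabryBridge : Prop :=
  Summit.RiemannHypothesis.RiemannHypothesis.Theses.ScrewFabry.FabryFact → ∀ h : ℝ, 0 < h → ∀ Δ : ℝ, 0 ≤ Δ → (∀ r : ℝ, 0 < r → r < 1 → ∀ ε : ℝ, 0 < ε → ∃ T : ℝ, ∀ t : ℝ, T ≤ t → (Set.ncard {m : ℕ | t < m ∧ (m : ℝ) ≤ (1 + r) * t ∧ Literature.NumberTheory.LFunctions.zetaScrew (m * h) < 0} : ℝ) ≤ (Δ / 2 + ε) * (r * t)) → (∀ z : ℂ, ‖z‖ < 1 → |Complex.arg z| ≤ Real.pi * Δ → z ∉ closure (Theorems.Splittings.ScrewLatticeContinuation.aliasedPoleSet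 h)) → Theorems.Splittings.ScrewLatticeContinuation.LatticeCeiling h

-- `FabryBridge` holds: proved by `Summit.RiemannHypothesis.RiemannHypothesis.Theorems.ScrewFabry.fabryBridge_proof` (its module imports this route file, so no `_holds` link can be stated here).

/-- item stmt-RiemannHypothesis-23059 · support · rank 9 · open · by planner
sources: Suzuki2023, corpus:book:ross2002-generalized-analytic-continuation p33
[support] TW(1): the closed wall has zero length in 𝔻 (row X-10's hypothesis; RH-implied,
`thinWall_of_rh`). [difficulty: open-problem] -/
@[route_item "route-RiemannHypothesis-ScrewFabry", crux]
def ThinWallOne : Prop :=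
  Theorems.Splittings.ScrewLatticeThinWall.ThinWall 1

/-- item stmt-RiemannHypothesis-23060 · assembly · rank 1 · closed · proved by Summit.RiemannHypothesis.RiemannHypothesis.Theorems.ScrewFabry.assembly_proof (prover) · by planner
sources: Suzuki2023
[assembly] FabryFact → FabryBridge → SectorExchange → ThinWallOne → RH (provable now; proof =
Sketch5.lean `assembly_holds`). -/
@[route_item "route-RiemannHypothesis-ScrewFabry", crux]
def Assembly : Prop :=
  FabryFact → FabryBridge → SectorExchange → ThinWallOne → Summit.RiemannHypothesis

-- `Assembly` holds: proved by `Summit.RiemannHypothesis.RiemannHypothesis.Theorems.ScrewFabry.assembly_proof` (its module imports this route file, so no `_holds` link can be stated here).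

/-! D-0027 §2.1 — DECIDING THEOREM (planner-authored via `route open/edit --closes-file`; by planner-rh-idea-1-g0-0 2026-08-27T22:10:21Z):
its hypotheses are this route's items and its conclusion the sub-problem Statement (glue_lint), and it elaborates with this file. -/

@[closes "route-RiemannHypothesis-ScrewFabry"] theorem closes (h₁ : FabryBridge) (h₂ : SectorExchange) (h₃ : FabryFact) (h₄ : ThinWallOne)
    (hA : Assembly) : Summit.RiemannHypothesis := hA h₃ h₁ h₂ h₄

end Summit.RiemannHypothesis.RiemannHypothesis.Theses.ScrewFabry
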